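/-
Copyright (c) 2026 the pub-hodgecm-mathlib formalisation cell (harness21).  Prover seat hodgecm-mathlib-LH4-p09 (g8), req620 Track A «(D-RAM) FOUR-FRAME» squad
(heir dealer LH4-plan (g13) WORD #74 (2): (d) lev-trunk assembly, PART 1).  2026-09-04.
-/
import Summits.HodgeConjecture.HodgeConjecture.Theorems.F0P3cDyRamLabelledKappaSplitStrata             -- ★ p859655 (F0P3a-p01 (g36)): two-token split heads `…_{core,T1,T2,T3}_sep_{two,levels}`
import Summits.HodgeConjecture.HodgeConjecture.Theorems.F0P3cDyRamSqTokenReadLetter                    -- ★ p860043 (this seat) (o2): `v_sq_sub_sq_le`, `sqToken_outerRead_H_iff`, numeric H foot; brings T2a ★ p859999, T1 ★ p859918, K3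
import Summits.HodgeConjecture.HodgeConjecture.Theorems.F0P3cDyRamLabelledKappaGluedSocketsOffLocus      -- ★ p859714 (LH4-p12 (g7)): `…_H_sep_latticeInLevel_of_ne` (one-token off-locus κH socket)
import HarnessLib

/-!
# (D-RAM) four-frame, STAGE 1b — (d) LEV-TRUNK ASSEMBLY, PART 1: the SPLIT cells `core ∕ T1 ∕ T2 ∕ T3` and the CORE-HANGING cell `H(ρ)` of the two-token labelled κ-table
# at the letters of record, IN THE CURRENCY OF F0P3a-p01 (g36)'s `LevLabelledBoxSum (ℓ₁ ℓ₂)` (p860066: binders `hcore ∕ hT1 ∕ hT2 ∕ hT3 ∕ hH` token for token)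

Helper brick for dealer LH4-plan (g13) WORD #74 (2) ((d) `LevTrunksOfBoxSum`, this seat, second hand to F0P3a-p01 (g36)): `Theorems/` only, statement-first, ★-only imports,
lane `--supports stmt-HodgeConjecture-24833 --as helper`; PAYS NO tier-0 row (count-neutral).  Twin of LH4-p12 (g7)'s ★ p859990 `SqLabelledCellsSplit` for two tokens.
Under the box-sum fence `2d ≤ nᵢ + 1`, `ℓ₁ ≤ 2`, `ℓ₂ ≤ nᵢ`:
* §1 `cell_core` (= 0, ★ p859655), `cell_T1 ∕ cell_T2 ∕ cell_T3` (`= [i = j][2d ≤ s][2 ∣ s][s + ℓ₁ ≤ n_apex]·ω·q^{s∕2}` — ★ p859655 `…_Tj_sep_levels` whose reads collapse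
  under the fence: the `D₂` read and T3's symbolic `|(β−1)²−(α−1)²| ≤ |ϖ|^{ℓ₂+s}` follow from `ℓ₂ ≤ nᵢ` via ★ p860043 `v_sq_sub_sq_le`).
* §2 H-emptiness for any summand (`finsum_stratum_H_sep_eq_zero_of_{ne,lt_rho,ne₃}'`, ★ (D1) `coreHangingStratum_eq_empty_of_*`) and the tube head with the
  VACUITY hypothesis `ℓ₂ + 2ρ ≤ 2n₂` in place of T2a's guard `ℓ₂ ≤ 2ρ` (`finsum_kappaCount_mul_stabiliserWeight_stratum_H_sep_levels_tube_of_vac`, numeric reads).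
* §3 **`cell_H`**: `Σᶠ_{H(ρ), L₁ ∧ L₂} κᵢ·w = [n₁ = n₂ = n₃ ∧ n₁ < 2ρ + ℓ₁ ∧ E′ ≤ n₁ − d + 1 ∧ d ≤ ⌈E′∕2⌉ ∧ ℓ₁ + ρ ≤ n₁ ∧ 2ρ + ℓ₂ ≤ 2n₁] · χᴴᵢ(f₀) · q^{2ρ−⌈E′∕2⌉}`,
  `E′ = ℓ₁ + 2ρ − n₁`, `f₀` the trunk's deepest glue witness (`hf₀ : n₂ = n₃ → n₂ ≤ n₁ → |f₀ + g₀| ≤ |ϖ|^{n₁−d+1}`) — `hH` of `LevLabelledBoxSum` with `εH := χᴴᵢ(f₀)`.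

HONEST LABEL: helper assembly for HYPOTHESES (the four lev trunk letters `hTrunkLo∕Hi∕CLo∕CHi` of ★ p859769 ∕ ★ p859848); STAGE-1b tier-0 rows and the ED. 5∕6 law stubs
stay OPEN; HC_CM is proved only modulo the 7 printed citations (2 remaining named inputs: hLiu418 = `stmt-HodgeConjecture-24832`, h413 = `stmt-HodgeConjecture-24833`) until rung 0 closes.

## References
* [Kottwitz1986BaseChangeUnits] R. E. Kottwitz, *Base change for unit elements of Hecke algebras*, Compositio Math. 60 (1986), §1 pp. 240–241 (κ-orbital integrals of units as signed lattice counts).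
* [LanglandsShelstad1987] R. P. Langlands, D. Shelstad, *On the definition of transfer factors*, Math. Ann. 278 (1987), §3 (κ as a character).
* [Rogawski1990] J. D. Rogawski, *Automorphic Representations of Unitary Groups in Three Variables*, Ann. of Math. Stud. 123 (1990), §4.9 Prop. 4.9.1 (a)(b) p. 55.
* [Serre1979] J.-P. Serre, *Local Fields*, GTM 67 (1979), Ch. V §3 Prop. 5, Cor. 3 (norm residue symbol; glue-unit rationality depth).
-/

set_option autoImplicit false

noncomputable section

namespace Summit.HodgeConjecture.HodgeConjecture.Cruxes.H413.F0P3cDyRamLevLabelledCellsSplitH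

open Matrix WithZero
open Literature.NumberTheory.Automorphic Literature.NumberTheory.Automorphic.HermitianLattice Literature.NumberTheory.Automorphic.UnitaryGroup
open Literature.NumberTheory.Automorphic.UnitaryLatticeTree Literature.NumberTheory.Automorphic.UnitaryThreeFourFrame
open Literature.NumberTheory.LocalFields.WildQuadraticDatum
open Summit.HodgeConjecture.HodgeConjecture.Cruxes.H413.F0P3cDyRamDiagonalTorusDefs
open Summit.HodgeConjecture.HodgeConjecture.Cruxes.H413.F0P3cDyRamDiagonalStrataDefs
open Summit.HodgeConjecture.HodgeConjecture.Cruxes.H413.F0P3cDyRamDiagonalKappaCountDefs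
open Summit.HodgeConjecture.HodgeConjecture.Cruxes.H413.F0P3cDyRamDiagonalGluedStabiliserIndex (ne_zero_and_v_lt_one_of_v_eq_exp)
open Summit.HodgeConjecture.HodgeConjecture.Cruxes.H413.F0P3cDyRamDiagonalCoreHangingFoot (coreHangingStratum_eq_empty_of_ne coreHangingStratum_eq_empty_of_lt_rho coreHangingStratum_eq_empty_of_ne₃)
open Summit.HodgeConjecture.HodgeConjecture.Cruxes.H413.F0P3cDyRamDiagonalCoreHangingSocket (stratum_H_eq)
open Summit.HodgeConjecture.HodgeConjecture.Cruxes.H413.F0P3cDyRamDiagonalKappaCoreHangingSocket (finsum_kappaCount_mul_stabiliserWeight_hasAxis_H)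
open Summit.HodgeConjecture.HodgeConjecture.Cruxes.H413.F0P3cDyRamElementDatumParity (isoceles_of_isElementDatum)
open Summit.HodgeConjecture.HodgeConjecture.Cruxes.H413.F0P3cDyRamFourFrameCensusDefs
open Summit.HodgeConjecture.HodgeConjecture.Cruxes.H413.F0P3cDyRamLabelledSplitStrata (finsum_mem_sep_eq_ite_of_forall_iff)
open Summit.HodgeConjecture.HodgeConjecture.Cruxes.H413.F0P3cDyRamLabelledKappaSplitStrata
open Summit.HodgeConjecture.HodgeConjecture.Cruxes.H413.F0P3cDyRamLabelledGluedLocusCensusFoot (glueRatio_modelToken_eq)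
open Summit.HodgeConjecture.HodgeConjecture.Cruxes.H413.F0P3cDyRamLabelledCoreHangingLocusCensusClosed (modelToken_data_H)
open Summit.HodgeConjecture.HodgeConjecture.Cruxes.H413.F0P3cDyRamLabelledKappaCoreHangingLocusClosed
open Summit.HodgeConjecture.HodgeConjecture.Cruxes.H413.F0P3cDyRamLabelledKappaSqTokenCells (sqToken_differences)
open Summit.HodgeConjecture.HodgeConjecture.Cruxes.H413.F0P3cDyRamLabelledTwoTokenReductions
open Summit.HodgeConjecture.HodgeConjecture.Cruxes.H413.F0P3cDyRamLabelledKappaTwoTokenCoreHanging (exists_fixed_near_neg_glueUnit_iff)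
open Summit.HodgeConjecture.HodgeConjecture.Cruxes.H413.F0P3cDyRamSqTokenReadLetter
open Summit.HodgeConjecture.HodgeConjecture.Cruxes.H413.F0P3cDyRamLabelledKappaGluedSocketsOffLocus (finsum_kappaCount_mul_stabiliserWeight_stratum_H_sep_latticeInLevel_of_ne)
open scoped Valued WithZero Matrix MatrixGroups

variable {K : Type} [Field K] [Valued K ℤᵐ⁰] [CompleteSpace K] [Fintype 𝓀[K]] {σ : K →+* K} {ϖ : K} {d t : ℕ} {α β : K} {N₀ n₁ n₂ n₃ : ℕ}
  {T : GL (Fin 3) K}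

/-! ## §1  Split cells in box-sum currency -/

/-- **CORE CELL** `= 0` (★ p859655 `…_core_sep_two`) — `hcore`. [cite: Kottwitz1986BaseChangeUnits, §1 pp. 240–241] -/
theorem cell_core (hD : IsRamifiedQuadraticDatum σ ϖ d t) (hE : IsElementDatum σ ϖ N₀ α β n₁ n₂ n₃) (hT : (T : Matrix (Fin 3) (Fin 3) K) = Matrix.diagonal ![α, β, 1])
    (i : Fin 3) (ℓ₁ ℓ₂ : ℕ) :
    ∑ᶠ M ∈ {M | M ∈ stratum σ ϖ T ![0, 0, 0] ∧
        (LatticeInLevel ϖ ℓ₁ (Matrix.diagonal ![α - 1, β - 1, 0]) M ∧ LatticeInLevel ϖ ℓ₂ (Matrix.diagonal ![(α - 1) * (α - 1), (β - 1) * (β - 1), 0]) M)},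
        (kappaCount σ ϖ 0 i M : ℚ) * stabiliserWeight σ M = 0 :=
  finsum_kappaCount_mul_stabiliserWeight_core_sep_two hD hE hT i ℓ₁ ℓ₂ _ _

/-- **SPLIT CELL T1 `(0,s,s)`** `= [i = 0][2d ≤ s][2 ∣ s][s + ℓ₁ ≤ n₁]·ω·q^{s∕2}` — `hT1`. [cite: Kottwitz1986BaseChangeUnits, §1 pp. 240–241] [cite: Rogawski1990, §4.9 Prop. 4.9.1 (a) p. 55] -/
theorem cell_T1 (hD : IsRamifiedQuadraticDatum σ ϖ d t) (hE : IsElementDatum σ ϖ N₀ α β n₁ n₂ n₃) (hT : (T : Matrix (Fin 3) (Fin 3) K) = Matrix.diagonal ![α, β, 1])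
    (hd2 : 2 ≤ d) (hfence : 2 * d ≤ n₁ + 1 ∧ 2 * d ≤ n₂ + 1 ∧ 2 * d ≤ n₃ + 1) {ℓ₁ ℓ₂ : ℕ} (hℓ₁ : ℓ₁ ≤ 2) (hℓ₂ : ℓ₂ ≤ n₁ ∧ ℓ₂ ≤ n₂ ∧ ℓ₂ ≤ n₃)
    (s : ℕ) (hs : 1 ≤ s) (i : Fin 3) :
    ∑ᶠ M ∈ {M | M ∈ stratum σ ϖ T ![0, s, s] ∧
        (LatticeInLevel ϖ ℓ₁ (Matrix.diagonal ![α - 1, β - 1, 0]) M ∧ LatticeInLevel ϖ ℓ₂ (Matrix.diagonal ![(α - 1) * (α - 1), (β - 1) * (β - 1), 0]) M)},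
        (kappaCount σ ϖ 0 i M : ℚ) * stabiliserWeight σ M =
      if i = 0 ∧ 2 * d ≤ s ∧ 2 ∣ s ∧ s + ℓ₁ ≤ n₁ then (normSign σ (-1 : K) : ℚ) * (Fintype.card 𝓀[K] : ℚ) ^ (s / 2) else 0 := by
  rw [finsum_kappaCount_mul_stabiliserWeight_T1_sep_levels hD hE hT s hs i ℓ₁ ℓ₂]
  by_cases hX : i = 0 ∧ 2 * d ≤ s ∧ 2 ∣ s ∧ s + ℓ₁ ≤ n₁
  · rw [if_pos hX, if_pos (show (ℓ₁ ≤ n₂ ∧ ℓ₁ + s ≤ n₁) ∧ (ℓ₂ ≤ 2 * n₂ ∧ ℓ₂ + s ≤ 2 * n₁) by omega), if_pos (by omega)]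
  · rw [if_neg hX]
    split_ifs with h h' <;> first | rfl | (exfalso; exact hX ⟨h'.1, h'.2.1, h'.2.2.1, by omega⟩)

/-- **SPLIT CELL T2 `(s,0,s)`** `= [i = 1][2d ≤ s][2 ∣ s][s + ℓ₁ ≤ n₂]·ω·q^{s∕2}` — `hT2`. [cite: Kottwitz1986BaseChangeUnits, §1 pp. 240–241] [cite: Rogawski1990, §4.9 Prop. 4.9.1 (a) p. 55] -/
theorem cell_T2 (hD : IsRamifiedQuadraticDatum σ ϖ d t) (hE : IsElementDatum σ ϖ N₀ α β n₁ n₂ n₃) (hT : (T : Matrix (Fin 3) (Fin 3) K) = Matrix.diagonal ![α, β, 1])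
    (hd2 : 2 ≤ d) (hfence : 2 * d ≤ n₁ + 1 ∧ 2 * d ≤ n₂ + 1 ∧ 2 * d ≤ n₃ + 1) {ℓ₁ ℓ₂ : ℕ} (hℓ₁ : ℓ₁ ≤ 2) (hℓ₂ : ℓ₂ ≤ n₁ ∧ ℓ₂ ≤ n₂ ∧ ℓ₂ ≤ n₃)
    (s : ℕ) (hs : 1 ≤ s) (i : Fin 3) :
    ∑ᶠ M ∈ {M | M ∈ stratum σ ϖ T ![s, 0, s] ∧
        (LatticeInLevel ϖ ℓ₁ (Matrix.diagonal ![α - 1, β - 1, 0]) M ∧ LatticeInLevel ϖ ℓ₂ (Matrix.diagonal ![(α - 1) * (α - 1), (β - 1) * (β - 1), 0]) M)},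
        (kappaCount σ ϖ 0 i M : ℚ) * stabiliserWeight σ M =
      if i = 1 ∧ 2 * d ≤ s ∧ 2 ∣ s ∧ s + ℓ₁ ≤ n₂ then (normSign σ (-1 : K) : ℚ) * (Fintype.card 𝓀[K] : ℚ) ^ (s / 2) else 0 := by
  rw [finsum_kappaCount_mul_stabiliserWeight_T2_sep_levels hD hE hT s hs i ℓ₁ ℓ₂]
  by_cases hX : i = 1 ∧ 2 * d ≤ s ∧ 2 ∣ s ∧ s + ℓ₁ ≤ n₂
  · rw [if_pos hX, if_pos (show (ℓ₁ ≤ n₁ ∧ ℓ₁ + s ≤ n₂) ∧ (ℓ₂ ≤ 2 * n₁ ∧ ℓ₂ + s ≤ 2 * n₂) by omega), if_pos (by omega)]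
  · rw [if_neg hX]
    split_ifs with h h' <;> first | rfl | (exfalso; exact hX ⟨h'.1, h'.2.1, h'.2.2.1, by omega⟩)

/-- **SPLIT CELL T3 `(s,s,0)`** `= [i = 2][2d ≤ s][2 ∣ s][s + ℓ₁ ≤ n₃]·ω·q^{s∕2}` — `hT3` (the symbolic conjunct `|(β−1)²−(α−1)²| ≤ |ϖ|^{ℓ₂+s}` of ★ p859655 follows from
`ℓ₂ ≤ min(n₁,n₂)`, `s ≤ n₃` via ★ p860043 `v_sq_sub_sq_le`). [cite: Kottwitz1986BaseChangeUnits, §1 pp. 240–241] [cite: Rogawski1990, §4.9 Prop. 4.9.1 (a) p. 55] -/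
theorem cell_T3 (hD : IsRamifiedQuadraticDatum σ ϖ d t) (hE : IsElementDatum σ ϖ N₀ α β n₁ n₂ n₃) (hT : (T : Matrix (Fin 3) (Fin 3) K) = Matrix.diagonal ![α, β, 1])
    (hd2 : 2 ≤ d) (hfence : 2 * d ≤ n₁ + 1 ∧ 2 * d ≤ n₂ + 1 ∧ 2 * d ≤ n₃ + 1) {ℓ₁ ℓ₂ : ℕ} (hℓ₁ : ℓ₁ ≤ 2) (hℓ₂ : ℓ₂ ≤ n₁ ∧ ℓ₂ ≤ n₂ ∧ ℓ₂ ≤ n₃)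
    (s : ℕ) (hs : 1 ≤ s) (i : Fin 3) :
    ∑ᶠ M ∈ {M | M ∈ stratum σ ϖ T ![s, s, 0] ∧
        (LatticeInLevel ϖ ℓ₁ (Matrix.diagonal ![α - 1, β - 1, 0]) M ∧ LatticeInLevel ϖ ℓ₂ (Matrix.diagonal ![(α - 1) * (α - 1), (β - 1) * (β - 1), 0]) M)},
        (kappaCount σ ϖ 0 i M : ℚ) * stabiliserWeight σ M =
      if i = 2 ∧ 2 * d ≤ s ∧ 2 ∣ s ∧ s + ℓ₁ ≤ n₃ then (normSign σ (-1 : K) : ℚ) * (Fintype.card 𝓀[K] : ℚ) ^ (s / 2) else 0 := by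
  obtain ⟨-, -, hϖ, -, -, -, -⟩ := id hD
  obtain ⟨-, -, -, -, -, h₁, h₂, h₃, -, -, -⟩ := id hE
  obtain ⟨-, hϖ1⟩ := ne_zero_and_v_lt_one_of_v_eq_exp hϖ
  have hple : ∀ m n : ℕ, Valued.v ϖ ^ m ≤ Valued.v ϖ ^ n ↔ n ≤ m := fun m n => UnitaryLatticeTree.v_pow_le_v_pow_iff hϖ m n
  rw [finsum_kappaCount_mul_stabiliserWeight_T3_sep_levels hD hE hT s hs i ℓ₁ ℓ₂]
  by_cases hX : i = 2 ∧ 2 * d ≤ s ∧ 2 ∣ s ∧ s + ℓ₁ ≤ n₃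
  · have hsq : Valued.v ((β - 1) * (β - 1) - (α - 1) * (α - 1)) ≤ Valued.v ϖ ^ (ℓ₂ + s) := by
      refine (v_sq_sub_sq_le hϖ1.le h₁ h₂ h₃).trans ((hple _ _).2 ?_)
      rcases le_total n₁ n₂ with h | h
      · rw [min_eq_left h]; omega
      · rw [min_eq_right h]; omega
    have hread : (ℓ₁ ≤ n₂ ∧ ℓ₁ ≤ n₁ ∧ ℓ₁ + s ≤ n₃) ∧
        (ℓ₂ ≤ 2 * n₂ ∧ ℓ₂ ≤ 2 * n₁ ∧ Valued.v ((β - 1) * (β - 1) - (α - 1) * (α - 1)) ≤ Valued.v ϖ ^ (ℓ₂ + s)) :=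
      ⟨⟨by omega, by omega, by omega⟩, by omega, by omega, hsq⟩
    rw [if_pos hX, if_pos hread, if_pos (by omega)]
  · rw [if_neg hX]
    split_ifs with h h' <;> first | rfl | (exfalso; exact hX ⟨h'.1, h'.2.1, h'.2.2.1, by omega⟩)

/-! ## §2  H: emptiness for any summand, and the tube head under the vacuity hypothesis -/

omit [CompleteSpace K] [Fintype 𝓀[K]] in
/-- `n₁ ≠ n₂`, `¬(2ρ ≤ n₁ ∧ 2ρ ≤ n₂)` ⇒ `H(ρ)` is empty: every label-cut sum vanishes (any summand). [cite: Kottwitz1986BaseChangeUnits, §1 pp. 240–241] -/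
theorem finsum_stratum_H_sep_eq_zero_of_ne' (hD : IsRamifiedQuadraticDatum σ ϖ d t) (hE : IsElementDatum σ ϖ N₀ α β n₁ n₂ n₃)
    (hT : (T : Matrix (Fin 3) (Fin 3) K) = Matrix.diagonal ![α, β, 1]) (ρ : ℕ) (hρ : 1 ≤ ρ) (hne : n₁ ≠ n₂) (hlow : ¬ (2 * ρ ≤ n₁ ∧ 2 * ρ ≤ n₂))
    (L : Submodule 𝒪[K] (Fin 3 → K) → Prop) (w : Submodule 𝒪[K] (Fin 3 → K) → ℚ) :
    ∑ᶠ M ∈ {M | M ∈ stratum σ ϖ T ![2 * ρ, 2 * ρ, 2 * ρ] ∧ L M}, w M = 0 := by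
  obtain ⟨-, hvσ, hϖ, hfix, -, -, -⟩ := hD
  obtain ⟨hαn, hβn, -, -, -, h₁, h₂, -, -, -, -⟩ := hE
  have hset : {M | M ∈ stratum σ ϖ T ![2 * ρ, 2 * ρ, 2 * ρ] ∧ L M} = ∅ :=
    Set.eq_empty_of_forall_notMem fun M ⟨hM, _⟩ => by
      rw [stratum_H_eq hvσ hfix hϖ T hρ, coreHangingStratum_eq_empty_of_ne σ hϖ T hT
        (UnitaryThreeFourFrame.v_eq_one_of_mul_map_eq_one hvσ hαn) (UnitaryThreeFourFrame.v_eq_one_of_mul_map_eq_one hvσ hβn) h₁ h₂ hne hlow] at hM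
      exact hM
  rw [hset, finsum_mem_empty]

omit [CompleteSpace K] [Fintype 𝓀[K]] in
/-- `n₁ = n₂ < ρ` ⇒ `H(ρ)` is empty (any summand). [cite: Kottwitz1986BaseChangeUnits, §1 pp. 240–241] -/
theorem finsum_stratum_H_sep_eq_zero_of_lt_rho' (hD : IsRamifiedQuadraticDatum σ ϖ d t) (hE : IsElementDatum σ ϖ N₀ α β n₁ n₂ n₃)
    (hT : (T : Matrix (Fin 3) (Fin 3) K) = Matrix.diagonal ![α, β, 1]) (ρ : ℕ) (hρ : 1 ≤ ρ) (h12 : n₁ = n₂) (hlt : n₁ < ρ)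
    (L : Submodule 𝒪[K] (Fin 3 → K) → Prop) (w : Submodule 𝒪[K] (Fin 3 → K) → ℚ) :
    ∑ᶠ M ∈ {M | M ∈ stratum σ ϖ T ![2 * ρ, 2 * ρ, 2 * ρ] ∧ L M}, w M = 0 := by
  obtain ⟨-, hvσ, hϖ, hfix, -, -, -⟩ := hD
  obtain ⟨hαn, hβn, -, -, -, h₁, h₂, h₃, -, -, -⟩ := hE
  subst h12
  have h₃' : Valued.v (β - α) = Valued.v ϖ ^ n₃ := by rw [Valuation.map_sub_swap, h₃]
  have hset : {M | M ∈ stratum σ ϖ T ![2 * ρ, 2 * ρ, 2 * ρ] ∧ L M} = ∅ :=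
    Set.eq_empty_of_forall_notMem fun M ⟨hM, _⟩ => by
      rw [stratum_H_eq hvσ hfix hϖ T hρ, coreHangingStratum_eq_empty_of_lt_rho σ hϖ T hT
        (UnitaryThreeFourFrame.v_eq_one_of_mul_map_eq_one hvσ hαn) (UnitaryThreeFourFrame.v_eq_one_of_mul_map_eq_one hvσ hβn) h₁ h₂ h₃' hlt] at hM
      exact hM
  rw [hset, finsum_mem_empty]

omit [CompleteSpace K] [Fintype 𝓀[K]] in
/-- `n₁ = n₂ = m < 2ρ`, `n₃ ≠ m` ⇒ `H(ρ)` is empty (any summand). [cite: Kottwitz1986BaseChangeUnits, §1 pp. 240–241] -/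
theorem finsum_stratum_H_sep_eq_zero_of_ne₃' (hD : IsRamifiedQuadraticDatum σ ϖ d t) (hE : IsElementDatum σ ϖ N₀ α β n₁ n₂ n₃)
    (hT : (T : Matrix (Fin 3) (Fin 3) K) = Matrix.diagonal ![α, β, 1]) (ρ : ℕ) (hρ : 1 ≤ ρ) (h12 : n₁ = n₂) (hm : n₁ < 2 * ρ) (hn₃ : n₃ ≠ n₁)
    (L : Submodule 𝒪[K] (Fin 3 → K) → Prop) (w : Submodule 𝒪[K] (Fin 3 → K) → ℚ) :
    ∑ᶠ M ∈ {M | M ∈ stratum σ ϖ T ![2 * ρ, 2 * ρ, 2 * ρ] ∧ L M}, w M = 0 := by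
  obtain ⟨-, hvσ, hϖ, hfix, -, -, -⟩ := hD
  obtain ⟨hαn, hβn, -, -, -, h₁, h₂, h₃, -, -, -⟩ := hE
  subst h12
  have h₃' : Valued.v (β - α) = Valued.v ϖ ^ n₃ := by rw [Valuation.map_sub_swap, h₃]
  have hset : {M | M ∈ stratum σ ϖ T ![2 * ρ, 2 * ρ, 2 * ρ] ∧ L M} = ∅ :=
    Set.eq_empty_of_forall_notMem fun M ⟨hM, _⟩ => by
      rw [stratum_H_eq hvσ hfix hϖ T hρ, coreHangingStratum_eq_empty_of_ne₃ σ hϖ T hT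
        (UnitaryThreeFourFrame.v_eq_one_of_mul_map_eq_one hvσ hαn) (UnitaryThreeFourFrame.v_eq_one_of_mul_map_eq_one hvσ hβn) h₁ h₂ h₃' hm hn₃] at hM
      exact hM
  rw [hset, finsum_mem_empty]

open Classical in
/-- **TWO-TOKEN κ-H CELL, TUBE, UNDER THE VACUITY HYPOTHESIS `ℓ₂ + 2ρ ≤ 2n₂`** (`n₁ = n₂ ≥ 2ρ`, `ρ ≤ n₃`; T2a ★ p859999's tube head with its guard `ℓ₂ ≤ 2ρ` replaced by
what the proof uses, and the `D₂` read numeric by ★ p860043): `Σᶠ_{H, L₁ ∧ L₂} κᵢ·w = (0 if ℓ₁ + 2ρ ≤ n₂ ; [ℓ₁ + ρ ≤ n₂ ∧ n₃ = n₂ ∧ E′ ≤ n₃ − d + 1 ∧ 2d − 1 ≤ E′]·χᴴᵢ(f₀)·q^{2ρ−⌈E′∕2⌉})`,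
`E′ = ℓ₁ + 2ρ − n₂`. [cite: Kottwitz1986BaseChangeUnits, §1 pp. 240–241] [cite: LanglandsShelstad1987, §3] [cite: Serre1979, Ch. V §3 Prop. 5, Cor. 3] [cite: Rogawski1990, §4.9 Prop. 4.9.1 (a)(b) p. 55] -/
theorem finsum_kappaCount_mul_stabiliserWeight_stratum_H_sep_levels_tube_of_vac (hD : IsRamifiedQuadraticDatum σ ϖ d t) (h2 : Valued.v (2 : K) < 1)
    (hE : IsElementDatum σ ϖ N₀ α β n₁ n₂ n₃) (hN₀ : d ≤ N₀) (hT : (T : Matrix (Fin 3) (Fin 3) K) = Matrix.diagonal ![α, β, 1])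
    (ρ : ℕ) (hρ : 1 ≤ ρ) (h12 : n₁ = n₂) (htube : 2 * ρ ≤ n₂) (hn₃ : ρ ≤ n₃) (i : Fin 3) (ℓ₁ ℓ₂ : ℕ) (hvac₂ : ℓ₂ + 2 * ρ ≤ 2 * n₂) (f₀ : K) (hσf₀ : σ f₀ = f₀)
    (hf₀ : ℓ₁ + 2 * ρ - n₂ ≤ n₃ - d + 1 → Valued.v (f₀ + (β - 1) / (α - 1)) ≤ Valued.v ϖ ^ (ℓ₁ + 2 * ρ - n₂)) :
    ∑ᶠ M ∈ {M | M ∈ stratum σ ϖ T ![2 * ρ, 2 * ρ, 2 * ρ] ∧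
        (LatticeInLevel ϖ ℓ₁ (Matrix.diagonal ![α - 1, β - 1, 0]) M ∧ LatticeInLevel ϖ ℓ₂ (Matrix.diagonal ![(α - 1) * (α - 1), (β - 1) * (β - 1), 0]) M)},
        (kappaCount σ ϖ 0 i M : ℚ) * stabiliserWeight σ M =
      if ℓ₁ + 2 * ρ ≤ n₂ then 0
      else
        (if ℓ₁ + ρ ≤ n₂ ∧ n₃ = n₂ ∧ ℓ₁ + 2 * ρ - n₂ ≤ n₃ - d + 1 ∧ 2 * d - 1 ≤ ℓ₁ + 2 * ρ - n₂ then
            (((![normSign σ (-(1 + f₀)), normSign σ f₀ * normSign σ (-(1 + f₀)), normSign σ f₀] : Fin 3 → ℤ) i : ℤ) : ℚ) *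
              (Fintype.card 𝓀[K] : ℚ) ^ (2 * ρ - (ℓ₁ + 2 * ρ - n₂ + 1) / 2)
          else 0) := by
  classical
  obtain ⟨hσ, hvσ, hϖ, hfix, hd, -, -⟩ := id hD
  obtain ⟨-, -, -, -, -, h₁, h₂, h₃, -, -, -⟩ := id hE
  have h23 : n₂ ≤ n₃ := by
    rcases isoceles_of_isElementDatum hD hE with ⟨-, h⟩ | ⟨h, h'⟩ | ⟨h, h'⟩ <;> omega
  obtain ⟨hϖ0, hϖ1⟩ := ne_zero_and_v_lt_one_of_v_eq_exp hϖ
  obtain ⟨hk₁, hloc₁, h10₁, hout₁⟩ := modelToken_data_H hϖ h₁ h₂ h₃ h12 h23 ℓ₁ ρ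
  obtain ⟨hk₂, hloc₂⟩ := sqToken_differences h₁ h₂
  rw [h12] at hloc₂
  have hread0 : (![(α - 1) * (α - 1), (β - 1) * (β - 1), 0] : Fin 3 → K) 0 = (α - 1) * (α - 1) := rfl
  have hread1 : (![(α - 1) * (α - 1), (β - 1) * (β - 1), 0] : Fin 3 → K) 1 = (β - 1) * (β - 1) := rfl
  have hread2 : (![(α - 1) * (α - 1), (β - 1) * (β - 1), 0] : Fin 3 → K) 2 = 0 := rfl
  have hple : ∀ m n : ℕ, Valued.v ϖ ^ m ≤ Valued.v ϖ ^ n ↔ n ≤ m := fun m n => UnitaryLatticeTree.v_pow_le_v_pow_iff hϖ m n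
  have hpeq : ∀ m n : ℕ, Valued.v ϖ ^ m = Valued.v ϖ ^ n ↔ m = n := fun m n =>
    ⟨fun h => le_antisymm ((hple n m).1 h.ge) ((hple m n).1 h.le), fun h => by rw [h]⟩
  have hbridge := exists_fixed_near_neg_glueUnit_iff hD hE hN₀ h12 (ℓ₁ + 2 * ρ - n₂)
  rw [finsum_stratum_H_sep_and_eq_of_vacuous_right hD T ρ hρ ℓ₁ _ ℓ₂ (2 * n₂) _ hk₂ hloc₂ hvac₂, hread0, hread1, hread2,
    if_pos ((sqToken_outerRead_H_iff hϖ h₁ h₂ h₃ h12 h23 ℓ₂ ρ).2 (by omega))]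
  by_cases hvac₁ : ℓ₁ + 2 * ρ ≤ n₂
  · rw [if_pos hvac₁, finsum_mem_sep_eq_ite_of_forall_iff (stratum σ ϖ T ![2 * ρ, 2 * ρ, 2 * ρ]) _ _
        (fun M hM => latticeInLevel_iff_outer_of_mem_stratum_H_of_vacuous hD T ρ hρ ℓ₁ n₂ _ hk₁ hloc₁ hvac₁ hM),
      finsum_kappaCount_mul_stabiliserWeight_hasAxis_H hD h2 hE hN₀ hT ρ hρ i f₀ hσf₀ (fun _ _ h _ => absurd h (by omega))]
    have hin : ¬ (n₁ = n₂ ∧ n₂ = n₃ ∧ n₁ < 2 * ρ ∧ 2 * ρ - n₁ ≤ n₁ - d + 1 ∧ d ≤ (2 * ρ - n₁ + 1) / 2) := fun h => absurd h.2.2.1 (by omega)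
    rw [if_neg hin]
    exact ite_self _
  · rw [if_neg hvac₁]
    by_cases hwit : ℓ₁ + 2 * ρ - n₂ ≤ n₃ - d + 1
    · have hf := hf₀ hwit
      rw [finsum_kappaCount_mul_stabiliserWeight_stratum_H_sep_onLocus_tube_of_witness hD h2 hE hT ρ hρ ⟨by omega, htube⟩ hn₃ i ℓ₁ n₂ _ hk₁ hloc₁
          (by omega) hσf₀ (by rw [glueRatio_modelToken_eq]; exact hf)]
      simp only [hout₁]
      simp only [h10₁, hpeq]
      by_cases hℓ : ℓ₁ + ρ ≤ n₂
      · rw [if_pos hℓ]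
        by_cases hrest : n₃ = n₂ ∧ 2 * d - 1 ≤ ℓ₁ + 2 * ρ - n₂
        · rw [if_pos hrest, if_pos ⟨hℓ, hrest.1, hwit, hrest.2⟩]
        · rw [if_neg hrest, if_neg (fun h => hrest ⟨h.2.1, h.2.2.2⟩)]
      · rw [if_neg hℓ, if_neg (fun h => hℓ h.1)]
    · rw [if_neg (fun h => hwit h.2.2.1)]
      refine finsum_kappaCount_mul_stabiliserWeight_stratum_H_sep_onLocus_tube_of_no_witness hD h2 hE hT ρ hρ ⟨by omega, htube⟩ hn₃ i ℓ₁ n₂ _ hk₁ hloc₁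
        (by omega) ?_
      rw [glueRatio_modelToken_eq]
      rintro ⟨f, hσf, hf⟩
      exact hwit (hbridge.1 ⟨f, hσf, hf⟩)

/-! ## §3  The H cell in box-sum currency -/

open Classical in
/-- **CORE-HANGING CELL `H(ρ)` IN BOX-SUM CURRENCY** (fence `2d ≤ nᵢ + 1`, `ℓ₁ ≤ 2`, `ℓ₂ ≤ nᵢ`; `E′ = ℓ₁ + 2ρ − n₁`; `f₀` the trunk's deepest glue witness):
`Σᶠ_{H(ρ), L₁ ∧ L₂} κᵢ·w = [n₁ = n₂ ∧ n₂ = n₃ ∧ n₁ < 2ρ + ℓ₁ ∧ E′ ≤ n₁ − d + 1 ∧ d ≤ ⌈E′∕2⌉ ∧ ℓ₁ + ρ ≤ n₁ ∧ 2ρ + ℓ₂ ≤ 2n₁] · χᴴᵢ(f₀) · q^{2ρ−⌈E′∕2⌉}` — `hH` of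
`LevLabelledBoxSum` with `εH := χᴴᵢ(f₀)`.  Cases: `n₁ ≠ n₂` (empty, or tube with both tokens off-locus over ★ κH's `0`); `n₁ = n₂`: `< ρ` empty; foot — equilateral
(T2a numeric) or empty; tube — §2 (a bridge witness stands in for `f₀` when `n₃ ≠ n₂`, where the value is `0` anyway).
[cite: Kottwitz1986BaseChangeUnits, §1 pp. 240–241] [cite: LanglandsShelstad1987, §3] [cite: Serre1979, Ch. V §3 Prop. 5, Cor. 3] [cite: Rogawski1990, §4.9 Prop. 4.9.1 (a)(b) p. 55] -/
theorem cell_H (hD : IsRamifiedQuadraticDatum σ ϖ d t) (h2 : Valued.v (2 : K) < 1) (hE : IsElementDatum σ ϖ N₀ α β n₁ n₂ n₃) (hN₀ : d ≤ N₀)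
    (hT : (T : Matrix (Fin 3) (Fin 3) K) = Matrix.diagonal ![α, β, 1]) (hd2 : 2 ≤ d) (hfence : 2 * d ≤ n₁ + 1 ∧ 2 * d ≤ n₂ + 1 ∧ 2 * d ≤ n₃ + 1)
    {ℓ₁ ℓ₂ : ℕ} (hℓ₁ : ℓ₁ ≤ 2) (hℓ₂ : ℓ₂ ≤ n₁ ∧ ℓ₂ ≤ n₂ ∧ ℓ₂ ≤ n₃) (ρ : ℕ) (hρ : 1 ≤ ρ) (i : Fin 3) (f₀ : K) (hσf₀ : σ f₀ = f₀)
    (hf₀ : n₂ = n₃ → n₂ ≤ n₁ → Valued.v (f₀ + (β - 1) / (α - 1)) ≤ Valued.v ϖ ^ (n₁ - d + 1)) :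
    ∑ᶠ M ∈ {M | M ∈ stratum σ ϖ T ![2 * ρ, 2 * ρ, 2 * ρ] ∧
        (LatticeInLevel ϖ ℓ₁ (Matrix.diagonal ![α - 1, β - 1, 0]) M ∧ LatticeInLevel ϖ ℓ₂ (Matrix.diagonal ![(α - 1) * (α - 1), (β - 1) * (β - 1), 0]) M)},
        (kappaCount σ ϖ 0 i M : ℚ) * stabiliserWeight σ M =
      if n₁ = n₂ ∧ n₂ = n₃ ∧ n₁ < 2 * ρ + ℓ₁ ∧ ℓ₁ + 2 * ρ - n₁ ≤ n₁ - d + 1 ∧ d ≤ (ℓ₁ + 2 * ρ - n₁ + 1) / 2 ∧ ℓ₁ + ρ ≤ n₁ ∧ 2 * ρ + ℓ₂ ≤ 2 * n₁ then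
        (((![normSign σ (-(1 + f₀)), normSign σ f₀ * normSign σ (-(1 + f₀)), normSign σ f₀] : Fin 3 → ℤ) i : ℤ) : ℚ) *
          (Fintype.card 𝓀[K] : ℚ) ^ (2 * ρ - (ℓ₁ + 2 * ρ - n₁ + 1) / 2)
      else 0 := by
  classical
  obtain ⟨hσ, hvσ, hϖ, hfix, hd, hd1, -⟩ := id hD
  obtain ⟨-, -, -, -, -, h₁, h₂, h₃, -, -, -⟩ := id hE
  obtain ⟨hϖ0, hϖ1⟩ := ne_zero_and_v_lt_one_of_v_eq_exp hϖ
  have hple : ∀ m n : ℕ, Valued.v ϖ ^ m ≤ Valued.v ϖ ^ n ↔ n ≤ m := fun m n => UnitaryLatticeTree.v_pow_le_v_pow_iff hϖ m n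
  have hpeq : ∀ m n : ℕ, Valued.v ϖ ^ m = Valued.v ϖ ^ n ↔ m = n := fun m n =>
    ⟨fun h => le_antisymm ((hple n m).1 h.ge) ((hple m n).1 h.le), fun h => by rw [h]⟩
  by_cases h12 : n₁ = n₂
  · by_cases hlt : n₁ < ρ
    · rw [finsum_stratum_H_sep_eq_zero_of_lt_rho' hD hE hT ρ hρ h12 hlt, if_neg (fun h => absurd h.2.2.2.2.2.1 (by omega))]
    by_cases hm : n₁ < 2 * ρ
    · -- foot regime
      by_cases h13 : n₃ = n₁
      · rw [finsum_kappaCount_mul_stabiliserWeight_stratum_H_sep_levels_foot_numeric hD h2 hE hN₀ hT ρ hρ h12 h13.symm (by omega) hm i ℓ₁ ℓ₂ f₀ hσf₀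
            (fun hE' => (hf₀ (by omega) (by omega)).trans (pow_le_pow_right_of_le_one' hϖ1.le hE'))]
        by_cases hX : n₁ = n₂ ∧ n₂ = n₃ ∧ n₁ < 2 * ρ + ℓ₁ ∧ ℓ₁ + 2 * ρ - n₁ ≤ n₁ - d + 1 ∧ d ≤ (ℓ₁ + 2 * ρ - n₁ + 1) / 2 ∧ ℓ₁ + ρ ≤ n₁ ∧
            2 * ρ + ℓ₂ ≤ 2 * n₁
        · rw [if_pos hX, if_pos (by omega), if_pos (by omega)]
        · rw [if_neg hX]
          split_ifs with ha hb <;> first | rfl | (exfalso; exact hX ⟨h12, by omega, by omega, hb.2.1, by omega, hb.1, by omega⟩)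
      · rw [finsum_stratum_H_sep_eq_zero_of_ne₃' hD hE hT ρ hρ h12 hm h13, if_neg (fun h => h13 (by omega))]
    · -- tube regime
      have htube : 2 * ρ ≤ n₂ := by omega
      have h23le : n₂ ≤ n₃ := by
        rcases isoceles_of_isElementDatum hD hE with ⟨-, h⟩ | ⟨h, h'⟩ | ⟨h, h'⟩ <;> omega
      have hvac₂ : ℓ₂ + 2 * ρ ≤ 2 * n₂ := by omega
      -- a witness binder valid in every case
      have key : ∀ (f : K), σ f = f → (ℓ₁ + 2 * ρ - n₂ ≤ n₃ - d + 1 → Valued.v (f + (β - 1) / (α - 1)) ≤ Valued.v ϖ ^ (ℓ₁ + 2 * ρ - n₂)) →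
          (n₃ = n₂ → f = f₀) →
          ∑ᶠ M ∈ {M | M ∈ stratum σ ϖ T ![2 * ρ, 2 * ρ, 2 * ρ] ∧
              (LatticeInLevel ϖ ℓ₁ (Matrix.diagonal ![α - 1, β - 1, 0]) M ∧
                LatticeInLevel ϖ ℓ₂ (Matrix.diagonal ![(α - 1) * (α - 1), (β - 1) * (β - 1), 0]) M)},
              (kappaCount σ ϖ 0 i M : ℚ) * stabiliserWeight σ M =
            if n₁ = n₂ ∧ n₂ = n₃ ∧ n₁ < 2 * ρ + ℓ₁ ∧ ℓ₁ + 2 * ρ - n₁ ≤ n₁ - d + 1 ∧ d ≤ (ℓ₁ + 2 * ρ - n₁ + 1) / 2 ∧ ℓ₁ + ρ ≤ n₁ ∧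
                2 * ρ + ℓ₂ ≤ 2 * n₁ then
              (((![normSign σ (-(1 + f₀)), normSign σ f₀ * normSign σ (-(1 + f₀)), normSign σ f₀] : Fin 3 → ℤ) i : ℤ) : ℚ) *
                (Fintype.card 𝓀[K] : ℚ) ^ (2 * ρ - (ℓ₁ + 2 * ρ - n₁ + 1) / 2)
            else 0 := by
        intro f hσf hf hff₀
        rw [finsum_kappaCount_mul_stabiliserWeight_stratum_H_sep_levels_tube_of_vac hD h2 hE hN₀ hT ρ hρ h12 htube (by omega) i ℓ₁ ℓ₂ hvac₂ f hσf hf]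
        by_cases hvac₁ : ℓ₁ + 2 * ρ ≤ n₂
        · rw [if_pos hvac₁, if_neg (fun h => absurd h.2.2.1 (by omega))]
        · rw [if_neg hvac₁]
          by_cases hX : ℓ₁ + ρ ≤ n₂ ∧ n₃ = n₂ ∧ ℓ₁ + 2 * ρ - n₂ ≤ n₃ - d + 1 ∧ 2 * d - 1 ≤ ℓ₁ + 2 * ρ - n₂
          · rw [if_pos hX, hff₀ hX.2.1, if_pos ⟨h12, hX.2.1.symm, by omega, by omega, by omega, by omega, by omega⟩, h12]
          · rw [if_neg hX, if_neg (fun h => hX ⟨by omega, by omega, by omega, by omega⟩)]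
      by_cases h23 : n₃ = n₂
      · exact key f₀ hσf₀ (fun hE' => (hf₀ h23.symm (by omega)).trans (pow_le_pow_right_of_le_one' hϖ1.le (by omega))) (fun _ => rfl)
      · by_cases hwit : ℓ₁ + 2 * ρ - n₂ ≤ n₃ - d + 1
        · obtain ⟨f, hσf, hf⟩ := (exists_fixed_near_neg_glueUnit_iff hD hE hN₀ h12 (ℓ₁ + 2 * ρ - n₂)).2 hwit
          exact key f hσf (fun _ => hf) (fun h => absurd h h23)
        · exact key f₀ hσf₀ (fun h => absurd h hwit) (fun h => absurd h h23)
  · -- `n₁ ≠ n₂`: both tokens off their loci over ★ κH's tube value `0`, or an empty stratum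
    rw [if_neg (fun h => h12 h.1)]
    by_cases htube : 2 * ρ ≤ n₁ ∧ 2 * ρ ≤ n₂
    · obtain ⟨hk₂, hloc₂⟩ := sqToken_differences h₁ h₂
      have hne₂ : Valued.v ((![(α - 1) * (α - 1), (β - 1) * (β - 1), 0] : Fin 3 → K) 2 - (![(α - 1) * (α - 1), (β - 1) * (β - 1), 0] : Fin 3 → K) 1) ≠
          Valued.v ((![(α - 1) * (α - 1), (β - 1) * (β - 1), 0] : Fin 3 → K) 2 - (![(α - 1) * (α - 1), (β - 1) * (β - 1), 0] : Fin 3 → K) 0) := by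
        rw [hk₂, hloc₂, Ne, hpeq]; omega
      have hne₁ : Valued.v ((![α - 1, β - 1, 0] : Fin 3 → K) 2 - (![α - 1, β - 1, 0] : Fin 3 → K) 1) ≠
          Valued.v ((![α - 1, β - 1, 0] : Fin 3 → K) 2 - (![α - 1, β - 1, 0] : Fin 3 → K) 0) := by
        simp only [Matrix.cons_val_zero, Matrix.cons_val_one, Matrix.cons_val_two, Matrix.tail_cons, Matrix.head_cons, zero_sub, Valuation.map_neg, h₁, h₂,
          Ne, hpeq]
        exact h12
      rw [finsum_stratum_H_sep_and_eq_of_ne_right hD T ρ hρ ℓ₁ _ ℓ₂ _ hne₂,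
        finsum_kappaCount_mul_stabiliserWeight_stratum_H_sep_latticeInLevel_of_ne hD h2 hE hN₀ hT ρ hρ i f₀ hσf₀ (fun h => absurd h h12) ℓ₁ _ hne₁]
      have hin : ¬ (n₁ = n₂ ∧ n₂ = n₃ ∧ n₁ < 2 * ρ ∧ 2 * ρ - n₁ ≤ n₁ - d + 1 ∧ d ≤ (2 * ρ - n₁ + 1) / 2) := fun h => h12 h.1
      simp only [if_neg hin, ite_self]
    · exact finsum_stratum_H_sep_eq_zero_of_ne' hD hE hT ρ hρ h12 htube _ _

end Summit.HodgeConjecture.HodgeConjecture.Cruxes.H413.F0P3cDyRamLevLabelledCellsSplitH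

end
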